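import Literature.MathematicalPhysics.QuantumLattice.YangMillsHeatFlowProofs
import Literature.MathematicalPhysics.QuantumLattice.YangMillsClassicalGaugeProofs
import Literature.MathematicalPhysics.QuantumLattice.YangMillsClassicalPureGaugeProofs
import Literature.Geometry.Lorentzian.CoordMetricVariation
import Literature.Analysis.ODE.ParametricLinear
import Literature.Analysis.Calculus.SeeleyExtension
import HarnessLib

/-!
# Yang–Mills heat flow: gauge covariance, time-dependent gauge transformations, the gauge ODE

Sorry-free progress on the named fact
`Literature.MathematicalPhysics.QuantumLattice.Waldron2019_yangMillsFlow_flatTorus` (Waldron 2019,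
Cor. 1.2 with Struwe's short-time existence), step (S1) of the published architecture:
short-time existence of classical solutions of the Yang–Mills heat flow `∂ₜ A = −D_A^* F_A` is
proved (Donaldson–Kronheimer §6.3.1; Struwe 1994, §4.1 "Donaldson's Ansatz", with (16)–(18)) by the
**DeTurck trick** —
solve instead the strictly parabolic modified flow `∂ₜ Ã = −D_Ã^* F_Ã + D_Ã φ(Ã)` with
`φ(Ã) = −D_Ã^*(Ã − A₀)`, then gauge the extra term away with the time-dependent gauge
transformation `g` solving the ODE `∂ₜ g = g φ`, `g(0) = 1`: `A = g • Ã` solves the Yang–Mills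
heat flow with the same initial value. This file proves the gauge-theoretic half of that
argument on flat space `E` (finite-dimensional real inner product space; coefficients in a real
normed algebra `𝔸` with summable geometric series, e.g. `M_N(ℂ)`), in the conventions of
`YangMillsClassical` (`(g • A)_v = g A_v g⁻¹ − (∂_v g) g⁻¹`, `D_A φ = dφ + [A, φ]`,
`div_A F_A = Σ_μ D_μ F_{μ ·} = −D_A^* F_A`):

* `covDeriv_gaugeAct_conj` — `D_{g•A}(g φ g⁻¹) = g (D_A φ) g⁻¹` (adjoint sections);
* `divCurvature_gaugeAct` — **gauge covariance of the Yang–Mills vector field**,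
  `div_{g•A} F_{g•A} = g (div_A F_A) g⁻¹` for `C²` data (from `curvature_gaugeAct_holds`);
* `hasDerivAt_gaugeAct_tslice` — for a jointly smooth time-dependent `g` with `∂ₜ g = g φ`:
  `∂ₜ (g • Ã)_v = g (∂ₜ Ã_v − (D_Ã φ)_v) g⁻¹` (mixed partials of `g` commute);
* `deriv_gaugeAct_tslice_eq_divCurvature` — hence **if `Ã` solves the modified flow
  `∂ₜ Ã = div_Ã F_Ã + D_Ã φ` and `∂ₜ g = g φ`, then `g • Ã` solves the Yang–Mills heat flow**;
* `eqOn_of_gauge_ode` — one-sided uniqueness for `u' = u ψ(t)`;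
* `exists_gauge_of_ode` — **the gauge ODE `∂ₜ g = g φ`, `g(0) = 1`, has global solutions,
  invertible and jointly `C^∞` in space and time** for `φ` jointly `C^∞` on `[0, ε) × E`:
  Seeley extension of `φ` to negative times (`Literature.Analysis.Calculus.Seeley`), linear
  equations with the space point as parameter (`Literature.Analysis.ODE.exists_contDiffOn_linearODE_param`,
  Lang 1995, Ch. IV §1, Prop. 1.9), invertibility from `(u w)' = 0` and uniqueness.

The parabolic half (the modified flow is `∂ₜ Ã = ΔÃ +` lower order, and its solution by
semilinear parabolic theory) is not here. Everything is proved; no definition and no named fact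
is introduced.

References: S. K. Donaldson, P. B. Kronheimer, *The Geometry of Four-Manifolds* (1990), §2.1,
(2.1.7)–(2.1.11), §6.3.1 [DonaldsonKronheimer1990]; M. Struwe, *The Yang–Mills flow in four
dimensions*, Calc. Var. 2 (1994), §4, (16)–(18), §4.1 [Struwe1994]; A. Waldron, *Long-time existence for
Yang–Mills flow*, Invent. Math. 217 (2019), p. 3 [Waldron2019]; S. Lang, *Differential and
Riemannian Manifolds* (1995), Ch. IV §1 [Lang1995]; R. T. Seeley, Proc. AMS 15 (1964) [Seeley1964].
-/

noncomputable section

open scoped ContDiff Topology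
open Set Filter

namespace Literature.MathematicalPhysics.QuantumLattice

/-! ### Gauge covariance of the covariant derivative and of the Yang–Mills vector field -/

section Covariance

variable {E : Type*} [NormedAddCommGroup E] [InnerProductSpace ℝ E]
variable {𝔸 : Type*} [NormedRing 𝔸] [NormedAlgebra ℝ 𝔸] [HasSummableGeomSeries 𝔸]

/-- **Sections in the adjoint representation have covariant covariant derivatives**:
`D_{g•A}(g φ g⁻¹)(x)(u) = g(x) (D_A φ)(x)(u) g(x)⁻¹` for `g`, `φ` differentiable at `x`
(Leibniz rule with `d(g⁻¹) = −g⁻¹ (dg) g⁻¹`). Donaldson–Kronheimer (2.1.7)–(2.1.11). [folklore] -/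
theorem covDeriv_gaugeAct_conj (g : E → 𝔸ˣ) (A : Connection E 𝔸) {φ : E → 𝔸} {x : E}
    (hg : DifferentiableAt ℝ (fun y => (g y : 𝔸)) x) (hφ : DifferentiableAt ℝ φ x) (u : E) :
    covDeriv (gaugeAct g A) (fun y => (g y : 𝔸) * φ y * ((g y)⁻¹ : 𝔸ˣ)) x u =
      (g x : 𝔸) * covDeriv A φ x u * ((g x)⁻¹ : 𝔸ˣ) := by
  have h1 := hg.hasFDerivAt
  have h2 := hφ.hasFDerivAt
  have h3 := hasFDerivAt_val_inv_units g h1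
  have h := (h1.fun_mul' h2).fun_mul' h3
  simp only [covDeriv, gaugeAct_apply, Ring.lie_def]
  rw [h.fderiv]
  simp [mul_assoc, mul_add, add_mul, mul_sub, sub_mul]
  simp only [← mul_assoc]
  simp only [mul_assoc]
  noncomm_ring

variable [FiniteDimensional ℝ E]

/-- **Gauge covariance of the Yang–Mills vector field**: `div_{g•A} F_{g•A}(x) = g(x)
(div_A F_A)(x) g(x)⁻¹` (so `D^*F` transforms in the adjoint representation and the Yang–Mills
heat flow is gauge invariant under time-independent gauge transformations), for `C²` gauge
transformations and `C²` connections: termwise from `F_{g•A} = g F_A g⁻¹`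
(`curvature_gaugeAct_holds`) and `covDeriv_gaugeAct_conj`. Donaldson–Kronheimer §2.1, (6.2.8).
[folklore] -/
theorem divCurvature_gaugeAct (g : E → 𝔸ˣ) (A : Connection E 𝔸)
    (hg : ContDiff ℝ 2 fun y => (g y : 𝔸)) (hA : ContDiff ℝ 2 A) (x v : E) :
    divCurvature (gaugeAct g A) x v = (g x : 𝔸) * divCurvature A x v * ((g x)⁻¹ : 𝔸ˣ) := by
  set e := stdOrthonormalBasis ℝ E with he
  have hgd : Differentiable ℝ fun y => (g y : 𝔸) := hg.differentiable (by simp)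
  have hAd : Differentiable ℝ A := hA.differentiable (by simp)
  have hF : ∀ i, (fun y => curvature (gaugeAct g A) y (e i) v) =
      fun y => (g y : 𝔸) * curvature A y (e i) v * ((g y)⁻¹ : 𝔸ˣ) := fun i =>
    funext fun y => curvature_gaugeAct_holds g A hg hAd y (e i) v
  simp only [divCurvature, ← he]
  simp_rw [hF]
  have hterm : ∀ i, covDeriv (gaugeAct g A)
      (fun y => (g y : 𝔸) * curvature A y (e i) v * ((g y)⁻¹ : 𝔸ˣ)) x (e i) =
      (g x : 𝔸) * covDeriv A (fun y => curvature A y (e i) v) x (e i) * ((g x)⁻¹ : 𝔸ˣ) :=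
    fun i => covDeriv_gaugeAct_conj g A (hgd x) (differentiable_curvature_apply hA (e i) v x) (e i)
  simp_rw [hterm]
  rw [Finset.mul_sum, Finset.sum_mul]

end Covariance

/-! ### Time-dependent gauge transformations of time-dependent connections -/

section TimeDependent

variable {E : Type*} [NormedAddCommGroup E] [InnerProductSpace ℝ E]
variable {𝔸 : Type*} [NormedRing 𝔸] [NormedAlgebra ℝ 𝔸] [HasSummableGeomSeries 𝔸]

/-- **Time derivative of a gauge-transformed time-dependent connection.** Let `g : ℝ → E → 𝔸ˣ`
be jointly `C^∞` on `U × E` (`U` open in time) and solve the gauge ODE `∂ₜ g = g φ` there, with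
`φ(t, ·)` differentiable at `x`, and let `s ↦ Ã(s)(x)(v)` have derivative `α` at `t ∈ U`. Then
`s ↦ (g(s) • Ã(s))(x)(v) = g Ã_v g⁻¹ − (∂_v g) g⁻¹` has derivative
`g(t,x) (α − (D_{Ã(t)} φ(t))(x)(v)) g(t,x)⁻¹` at `t`: the terms `ġ Ã g⁻¹ − g Ã g⁻¹ ġ g⁻¹` give
`g [φ, Ã_v] g⁻¹`, and `∂ₜ(∂_v g) = ∂_v(∂ₜ g) = (∂_v g) φ + g ∂_v φ` (mixed partials of the jointly
smooth `g` commute). This is the computation behind the DeTurck trick for the Yang–Mills flow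
(Donaldson–Kronheimer §6.3.1; Struwe 1994, §4, (16)). [folklore] -/
theorem hasDerivAt_gaugeAct_tslice {U : Set ℝ} (hU : IsOpen U) {g : ℝ → E → 𝔸ˣ}
    {φ : ℝ → E → 𝔸} {Ã : ℝ → Connection E 𝔸}
    (hg : ContDiffOn ℝ ∞ (fun p : ℝ × E => (g p.1 p.2 : 𝔸)) (U ×ˢ (univ : Set E)))
    (hode : ∀ s ∈ U, ∀ y : E, deriv (fun s' => (g s' y : 𝔸)) s = (g s y : 𝔸) * φ s y)
    {t : ℝ} (ht : t ∈ U) {x : E} (hφ : DifferentiableAt ℝ (φ t) x) (v : E) {α : 𝔸}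
    (hÃ : HasDerivAt (fun s => Ã s x v) α t) :
    HasDerivAt (fun s => gaugeAct (g s) (Ã s) x v)
      ((g t x : 𝔸) * (α - covDeriv (Ã t) (φ t) x v) * ((g t x)⁻¹ : 𝔸ˣ)) t := by
  -- the joint map in the `E × ℝ` convention of `MetricCoord`
  set G : E × ℝ → 𝔸 := fun q => (g q.2 q.1 : 𝔸) with hG
  have hG' : ContDiffOn ℝ ∞ G ((univ : Set E) ×ˢ U) := by
    have h1 : G = (fun p : ℝ × E => (g p.1 p.2 : 𝔸)) ∘ (ContinuousLinearEquiv.prodComm ℝ E ℝ) :=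
      rfl
    have h2 : (ContinuousLinearEquiv.prodComm ℝ E ℝ) ⁻¹' (U ×ˢ (univ : Set E)) =
        (univ : Set E) ×ˢ U := by
      ext ⟨y, s⟩; simp
    rw [h1, ← h2]
    exact (ContinuousLinearEquiv.contDiffOn_comp_iff _).2 hg
  have hUn : U ∈ 𝓝 t := hU.mem_nhds ht
  -- (1) `s ↦ g s x` has derivative `g φ`
  have hg1 : HasDerivAt (fun s => (g s x : 𝔸)) ((g t x : 𝔸) * φ t x) t := by
    have hd : DifferentiableAt ℝ (fun s => (g s x : 𝔸)) t := by
      have hdw := (Literature.Geometry.Lorentzian.MetricCoord.hasDerivWithinAt_tslice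
        (hG'.differentiableOn (by simp)) (mem_univ x) ht).hasDerivAt hUn
      exact hdw.differentiableAt
    rw [← hode t ht x]
    exact hd.hasDerivAt
  -- (2) `s ↦ (g s x)⁻¹` has derivative `-g⁻¹ (g φ) g⁻¹ = -φ g⁻¹`
  have hg2 : HasDerivAt (fun s => (((g s x)⁻¹ : 𝔸ˣ) : 𝔸))
      (-(φ t x * (((g t x)⁻¹ : 𝔸ˣ) : 𝔸))) t := by
    have hfun : (fun s => (((g s x)⁻¹ : 𝔸ˣ) : 𝔸)) = Ring.inverse ∘ fun s => (g s x : 𝔸) := by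
      funext s; simp
    rw [hfun]
    have h := (hasFDerivAt_ringInverse (𝕜 := ℝ) (g t x)).comp_hasDerivAt t hg1
    simpa using h
  -- (3) `s ↦ ∂_v g(s, ·)(x)` has derivative `∂_v (g φ)(t, ·)(x)` (mixed partials commute)
  have hmix : HasDerivAt (fun s => fderiv ℝ (fun y => (g s y : 𝔸)) x)
      (fderiv ℝ (fun y => deriv (fun s => (g s y : 𝔸)) t) x) t := by
    have h := Literature.Geometry.Lorentzian.MetricCoord.hasDerivWithinAt_fderiv_slice isOpen_univ
      hU.uniqueDiffOn hG' (mem_univ x) ht (by rw [hU.interior_eq]; exact subset_closure ht)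
    have h' := h.hasDerivAt hUn
    have hcongr : (fun y => derivWithin (fun s => G (y, s)) U t) =
        fun y => deriv (fun s => (g s y : 𝔸)) t := by
      funext y
      exact derivWithin_of_isOpen hU ht
    rw [hcongr] at h'
    exact h'
  have hgφ : ∀ y, deriv (fun s => (g s y : 𝔸)) t = (g t y : 𝔸) * φ t y := fun y => hode t ht y
  have hdgφ : HasFDerivAt (fun y => (g t y : 𝔸) * φ t y)
      ((g t x : 𝔸) • fderiv ℝ (φ t) x + (fderiv ℝ (fun y => (g t y : 𝔸)) x).smulRight (φ t x)) x := by
    have hgt : DifferentiableAt ℝ (fun y => (g t y : 𝔸)) x := by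
      have hsl : ContDiff ℝ ∞ (fun y => (g t y : 𝔸)) := by
        have : (fun y => (g t y : 𝔸)) = (fun p : ℝ × E => (g p.1 p.2 : 𝔸)) ∘ fun y => (t, y) := rfl
        rw [this]
        exact hg.comp_contDiff (contDiff_const.prodMk contDiff_id) fun y => ⟨ht, mem_univ y⟩
      exact hsl.differentiable (by simp) x
    exact hgt.hasFDerivAt.mul' hφ.hasFDerivAt
  have hg3 : HasDerivAt (fun s => fderiv ℝ (fun y => (g s y : 𝔸)) x v)
      ((g t x : 𝔸) * fderiv ℝ (φ t) x v + fderiv ℝ (fun y => (g t y : 𝔸)) x v * φ t x) t := by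
    have h := hmix.clm_apply (hasDerivAt_const t v)
    simp only [map_zero, add_zero] at h
    have hval : fderiv ℝ (fun y => deriv (fun s => (g s y : 𝔸)) t) x v =
        (g t x : 𝔸) * fderiv ℝ (φ t) x v + fderiv ℝ (fun y => (g t y : 𝔸)) x v * φ t x := by
      have hfun : (fun y => deriv (fun s => (g s y : 𝔸)) t) = fun y => (g t y : 𝔸) * φ t y :=
        funext hgφ
      rw [hfun, hdgφ.fderiv]
      simp [smul_eq_mul]
    rw [hval] at h
    exact h
  -- assemble with the Leibniz rule
  have hprod := ((hg1.fun_mul hÃ).fun_mul hg2).fun_sub (hg3.fun_mul hg2)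
  have hfun : (fun s => gaugeAct (g s) (Ã s) x v) = fun s =>
      (g s x : 𝔸) * Ã s x v * (((g s x)⁻¹ : 𝔸ˣ) : 𝔸) -
        fderiv ℝ (fun y => (g s y : 𝔸)) x v * (((g s x)⁻¹ : 𝔸ˣ) : 𝔸) := by
    funext s; exact gaugeAct_apply (g s) (Ã s) x v
  rw [hfun]
  refine hprod.congr_deriv ?_
  simp only [covDeriv, Ring.lie_def]
  noncomm_ring

variable [FiniteDimensional ℝ E]

/-- **Gauging away the DeTurck term.** If `Ã` solves the modified flow
`∂ₜ Ã_v = Σ_μ D_μ F_{μ v} + (D_Ã φ)_v` on `U × E` (`U` open in time; `Ã(s)` of class `C²` and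
`s ↦ Ã(s)(x)(v)` differentiable, for `s ∈ U`) and the jointly smooth gauge transformation `g`
solves `∂ₜ g = g φ` on `U × E` (`φ(s, ·)` differentiable), then `A(s) = g(s) • Ã(s)` solves the
Yang–Mills heat flow `∂ₜ A_v = Σ_μ D_μ F_{μ v}` on `U × E` (`hasDerivAt_gaugeAct_tslice` and
gauge covariance of the Yang–Mills vector field, `divCurvature_gaugeAct`). This is the DeTurck
trick for the Yang–Mills flow (Donaldson–Kronheimer §6.3.1; Struwe 1994, §4, (16) and §4.1).
[folklore] -/
theorem deriv_gaugeAct_tslice_eq_divCurvature {U : Set ℝ} (hU : IsOpen U) {g : ℝ → E → 𝔸ˣ}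
    {φ : ℝ → E → 𝔸} {Ã : ℝ → Connection E 𝔸}
    (hg : ContDiffOn ℝ ∞ (fun p : ℝ × E => (g p.1 p.2 : 𝔸)) (U ×ˢ (univ : Set E)))
    (hode : ∀ s ∈ U, ∀ y : E, deriv (fun s' => (g s' y : 𝔸)) s = (g s y : 𝔸) * φ s y)
    (hφ : ∀ s ∈ U, Differentiable ℝ (φ s)) (hÃ : ∀ s ∈ U, ContDiff ℝ 2 (Ã s))
    (hÃt : ∀ s ∈ U, ∀ x v : E, DifferentiableAt ℝ (fun s' => Ã s' x v) s)
    (hpde : ∀ s ∈ U, ∀ x v : E, deriv (fun s' => Ã s' x v) s =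
      divCurvature (Ã s) x v + covDeriv (Ã s) (φ s) x v)
    {t : ℝ} (ht : t ∈ U) (x v : E) :
    HasDerivAt (fun s => gaugeAct (g s) (Ã s) x v) (divCurvature (gaugeAct (g t) (Ã t)) x v) t := by
  have h := hasDerivAt_gaugeAct_tslice hU hg hode ht ((hφ t ht) x) v ((hÃt t ht x v).hasDerivAt)
  have hgt : ContDiff ℝ 2 fun y => (g t y : 𝔸) := by
    have : (fun y => (g t y : 𝔸)) = (fun p : ℝ × E => (g p.1 p.2 : 𝔸)) ∘ fun y => (t, y) := rfl
    rw [this]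
    exact (hg.comp_contDiff (contDiff_const.prodMk contDiff_id) fun y => ⟨ht, mem_univ y⟩).of_le
      (WithTop.coe_le_coe.mpr le_top)
  rw [divCurvature_gaugeAct (g t) (Ã t) hgt (hÃ t ht) x v]
  refine h.congr_deriv ?_
  rw [hpde t ht x v]
  noncomm_ring

end TimeDependent

/-! ### The gauge ODE `∂ₜ g = g φ`: global solutions, smooth in space and time -/

section GaugeODE

universe u

variable {E : Type u} [NormedAddCommGroup E] [InnerProductSpace ℝ E] [CompleteSpace E]
variable {𝔸 : Type u} [NormedRing 𝔸] [NormedAlgebra ℝ 𝔸] [CompleteSpace 𝔸]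

omit [CompleteSpace 𝔸] in
/-- **Uniqueness for the gauge ODE, one-sided.** Two solutions of `u' = u ψ(t)` on `[0, b)`
(`ψ` continuous on `[0, b]`), continuous on `[0, b]` and equal at `t = 0`, agree on `[0, b]`
(the linear field is Lipschitz with constant `sup ‖ψ‖`; Mathlib's
`ODE_solution_unique_of_mem_Icc_right`). [folklore] -/
theorem eqOn_of_gauge_ode {b : ℝ} {ψ : ℝ → 𝔸} (hψ : ContinuousOn ψ (Icc 0 b)) {u₁ u₂ : ℝ → 𝔸}
    (hc₁ : ContinuousOn u₁ (Icc 0 b)) (hc₂ : ContinuousOn u₂ (Icc 0 b))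
    (h₁ : ∀ t ∈ Ico 0 b, HasDerivAt u₁ (u₁ t * ψ t) t)
    (h₂ : ∀ t ∈ Ico 0 b, HasDerivAt u₂ (u₂ t * ψ t) t) (h0 : u₁ 0 = u₂ 0) :
    EqOn u₁ u₂ (Icc 0 b) := by
  -- a bound for `ψ` on the compact interval
  obtain ⟨K, hK⟩ : ∃ K : ℝ, ∀ t ∈ Icc 0 b, ‖ψ t‖ ≤ K := by
    obtain ⟨K, hK⟩ := (isCompact_Icc.image_of_continuousOn hψ).isBounded.exists_norm_le
    exact ⟨K, fun t ht => hK _ (mem_image_of_mem ψ ht)⟩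
  have hK0 : 0 ≤ max K 0 := le_max_right _ _
  set v : ℝ → 𝔸 → 𝔸 := fun t w => w * ψ t with hv
  have hLip : ∀ t ∈ Ico (0 : ℝ) b, LipschitzOnWith ⟨max K 0, hK0⟩ (v t) univ := by
    intro t ht
    refine LipschitzOnWith.of_dist_le_mul fun w₁ _ w₂ _ => ?_
    rw [dist_eq_norm, dist_eq_norm]
    simp only [hv, ← sub_mul]
    calc ‖(w₁ - w₂) * ψ t‖ ≤ ‖w₁ - w₂‖ * ‖ψ t‖ := norm_mul_le _ _
      _ ≤ ‖w₁ - w₂‖ * max K 0 := by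
          gcongr
          exact (hK t (Ico_subset_Icc_self ht)).trans (le_max_left _ _)
      _ = ((⟨max K 0, hK0⟩ : NNReal) : ℝ) * ‖w₁ - w₂‖ := by rw [mul_comm]
  exact ODE_solution_unique_of_mem_Icc_right hLip hc₁
    (fun t ht => (h₁ t ht).hasDerivWithinAt) (fun _ _ => mem_univ _) hc₂
    (fun t ht => (h₂ t ht).hasDerivWithinAt) (fun _ _ => mem_univ _) h0

/-- **The gauge ODE has global solutions, jointly smooth in space and time.** Let
`φ : ℝ → E → 𝔸` be jointly `C^∞` on the slab `[0, ε) × E` (one-sided in time at `t = 0`). Then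
for every `0 < ε' < ε` there is `g : ℝ → E → 𝔸ˣ` with `g(0, ·) = 1`, `(t, x) ↦ g(t, x)` and
`(t, x) ↦ g(t, x)⁻¹` jointly `C^∞` on `(-ε', ε') × E`, solving `∂ₜ g = g φ` (and hence
`∂ₜ g⁻¹ = −φ g⁻¹`) for `t ∈ [0, ε')`. Proof: extend `φ` smoothly to negative times by Seeley's
extension operator (`Literature.Analysis.Calculus.Seeley.contDiffOn_extend`); solve the linear
equations `u' = u φ`, `u(0) = 1` and `w' = −φ w`, `w(0) = 1` with the space point as a parameter
(`Literature.Analysis.ODE.exists_contDiffOn_linearODE_param`: global solutions, `C^∞` jointly in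
parameter and time; Lang 1995, Ch. IV §1, Prop. 1.9); then `(u w)' = 0` gives `u w = 1`, and
`w u` solves `X' = X φ − φ X`, `X(0) = 1`, as does `X ≡ 1`, so `w u = 1` by uniqueness
(`Literature.Analysis.ODE.eqOn_of_hasDerivAt_linear`): `g = u` is invertible with inverse `w`. This
is the time-dependent gauge transformation of the DeTurck trick (Donaldson–Kronheimer §6.3.1;
Struwe 1994, §4.1, (18)). [folklore] -/
theorem exists_gauge_of_ode {ε : ℝ} (hε : 0 < ε) {φ : ℝ → E → 𝔸}
    (hφ : ContDiffOn ℝ ∞ (fun p : ℝ × E => φ p.1 p.2) (Ico 0 ε ×ˢ (univ : Set E)))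
    {ε' : ℝ} (hε' : 0 < ε') (hε'ε : ε' < ε) :
    ∃ g : ℝ → E → 𝔸ˣ, (∀ x, g 0 x = 1) ∧
      ContDiffOn ℝ ∞ (fun p : ℝ × E => (g p.1 p.2 : 𝔸)) (Ioo (-ε') ε' ×ˢ (univ : Set E)) ∧
      ContDiffOn ℝ ∞ (fun p : ℝ × E => (((g p.1 p.2)⁻¹ : 𝔸ˣ) : 𝔸)) (Ioo (-ε') ε' ×ˢ (univ : Set E)) ∧
      (∀ t ∈ Ico 0 ε', ∀ x : E, HasDerivAt (fun s => (g s x : 𝔸)) ((g t x : 𝔸) * φ t x) t) ∧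
      ∀ t ∈ Ico 0 ε', ∀ x : E,
        HasDerivAt (fun s => (((g s x)⁻¹ : 𝔸ˣ) : 𝔸)) (-(φ t x * (((g t x)⁻¹ : 𝔸ˣ) : 𝔸))) t := by
  -- Seeley extension of `φ` to negative times
  set f : ℝ × E → 𝔸 := fun p => φ p.1 p.2 with hf
  set Φ : ℝ × E → 𝔸 := Literature.Analysis.Calculus.Seeley.extend ε f with hΦ
  have hΦs : ContDiffOn ℝ ∞ Φ (Iio ε ×ˢ (univ : Set E)) :=
    Literature.Analysis.Calculus.Seeley.contDiffOn_extend hε isOpen_univ (by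
      simpa [Literature.Analysis.Calculus.Seeley.slab] using hφ)
  have hΦf : ∀ t, 0 ≤ t → ∀ x, Φ (t, x) = φ t x := fun t ht x =>
    Literature.Analysis.Calculus.Seeley.extend_of_nonneg (p := (t, x)) ht
  have hΦs' : ContDiffOn ℝ ∞ Φ (Ioo (-ε) ε ×ˢ (univ : Set E)) :=
    hΦs.mono (prod_mono Ioo_subset_Iio_self le_rfl)
  -- the coefficients `w ↦ w Φ` and `w ↦ -Φ w` as smooth fields of operators, space as parameter
  set μ : 𝔸 →L[ℝ] 𝔸 →L[ℝ] 𝔸 := ContinuousLinearMap.mul ℝ 𝔸 with hμ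
  set Ar : E → ℝ → 𝔸 →L[ℝ] 𝔸 := fun x t => μ.flip (Φ (t, x)) with hAr
  set Al : E → ℝ → 𝔸 →L[ℝ] 𝔸 := fun x t => -μ (Φ (t, x)) with hAl
  have hΦxt : ContDiffOn ℝ ∞ (fun q : E × ℝ => Φ (q.2, q.1)) ((univ : Set E) ×ˢ Ioo (-ε) ε) := by
    refine hΦs'.comp (contDiffOn_snd.prodMk contDiffOn_fst) ?_
    rintro ⟨x, t⟩ ⟨-, ht⟩
    exact ⟨ht, mem_univ x⟩
  have hAr' : ContDiffOn ℝ ∞ (fun q : E × ℝ => Ar q.1 q.2) ((univ : Set E) ×ˢ Ioo (-ε) ε) := by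
    simp only [hAr]
    exact (μ.flip.contDiff.comp_contDiffOn hΦxt)
  have hAl' : ContDiffOn ℝ ∞ (fun q : E × ℝ => Al q.1 q.2) ((univ : Set E) ×ˢ Ioo (-ε) ε) := by
    simp only [hAl]
    exact (μ.contDiff.comp_contDiffOn hΦxt).neg
  have h1 : (1 : ℕ∞) ≤ ⊤ := le_top
  obtain ⟨u, hu0, hud, hus⟩ := Literature.Analysis.ODE.exists_contDiffOn_linearODE_param
    (n := ⊤) h1 isOpen_univ hε' hε'ε hAr' (1 : 𝔸)
  obtain ⟨w, hw0, hwd, hws⟩ := Literature.Analysis.ODE.exists_contDiffOn_linearODE_param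
    (n := ⊤) h1 isOpen_univ hε' hε'ε hAl' (1 : 𝔸)
  simp only [hAr, hAl, hμ, ContinuousLinearMap.flip_apply, ContinuousLinearMap.mul_apply',
    neg_apply] at hud hwd
  -- `u w = 1`: the derivative of `u w` vanishes
  have huw : ∀ x, ∀ t ∈ Ioo (-ε') ε', u x t * w x t = 1 := by
    intro x
    have hd : ∀ t ∈ Ioo (-ε') ε', HasDerivAt (fun s => u x s * w x s) 0 t := by
      intro t ht
      have h := (hud x (mem_univ x) t ht).mul (hwd x (mem_univ x) t ht)
      refine h.congr_deriv ?_
      noncomm_ring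
    intro t ht
    have hconst := IsOpen.is_const_of_deriv_eq_zero (f := fun s => u x s * w x s) isOpen_Ioo
      (isPreconnected_Ioo) (fun s hs => (hd s hs).differentiableAt.differentiableWithinAt)
      (fun s hs => (hd s hs).deriv) ht ⟨by linarith, hε'⟩
    rw [hconst, hu0 x (mem_univ x), hw0 x (mem_univ x), one_mul]
  -- `w u = 1`: `w u` and `1` solve the same linear equation `X' = X Φ - Φ X`
  have hwu : ∀ x, ∀ t ∈ Ioo (-ε') ε', w x t * u x t = 1 := by
    intro x
    set Bx : ℝ → 𝔸 →L[ℝ] 𝔸 := fun t => μ.flip (Φ (t, x)) - μ (Φ (t, x)) with hBx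
    have hBc : ContinuousOn Bx (Ioo (-ε') ε') := by
      have hc : ContinuousOn (fun t => Φ (t, x)) (Ioo (-ε') ε') := by
        refine hΦs'.continuousOn.comp (continuousOn_id.prodMk continuousOn_const) ?_
        intro t ht
        exact ⟨⟨by linarith [ht.1], by linarith [ht.2]⟩, mem_univ x⟩
      simp only [hBx]
      exact (μ.flip.continuous.comp_continuousOn hc).sub (μ.continuous.comp_continuousOn hc)
    have hX : ∀ t ∈ Ioo (-ε') ε', HasDerivAt (fun s => w x s * u x s)
        (Bx t (w x t * u x t)) t := by
      intro t ht
      have h := (hwd x (mem_univ x) t ht).mul (hud x (mem_univ x) t ht)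
      refine h.congr_deriv ?_
      simp only [hBx, hμ, sub_apply, ContinuousLinearMap.flip_apply,
        ContinuousLinearMap.mul_apply']
      noncomm_ring
    have hone : ∀ t ∈ Ioo (-ε') ε', HasDerivAt (fun _ : ℝ => (1 : 𝔸)) (Bx t 1) t := by
      intro t ht
      have h : Bx t 1 = 0 := by
        simp [hBx, hμ]
      rw [h]
      exact hasDerivAt_const t 1
    have heq := Literature.Analysis.ODE.eqOn_of_hasDerivAt_linear (v₁ := fun s => w x s * u x s)
      (v₂ := fun _ => (1 : 𝔸)) (t₀ := 0) ⟨by linarith, hε'⟩ hBc hX hone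
      (by simp [hw0 x (mem_univ x), hu0 x (mem_univ x)])
    intro t ht
    exact heq ht
  -- the gauge transformation
  classical
  set g : ℝ → E → 𝔸ˣ := fun t x =>
    if ht : t ∈ Ioo (-ε') ε' then ⟨u x t, w x t, huw x t ht, hwu x t ht⟩ else 1 with hg
  have hgval : ∀ t ∈ Ioo (-ε') ε', ∀ x, (g t x : 𝔸) = u x t := by
    intro t ht x
    simp only [hg, dif_pos ht]
  have hginv : ∀ t ∈ Ioo (-ε') ε', ∀ x, (((g t x)⁻¹ : 𝔸ˣ) : 𝔸) = w x t := by
    intro t ht x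
    simp only [hg, dif_pos ht]
    rfl
  have h0mem : (0 : ℝ) ∈ Ioo (-ε') ε' := ⟨by linarith, hε'⟩
  refine ⟨g, fun x => ?_, ?_, ?_, ?_, ?_⟩
  · ext
    rw [hgval 0 h0mem x, hu0 x (mem_univ x)]
    rfl
  · have hus' : ContDiffOn ℝ ∞ (fun p : ℝ × E => u p.2 p.1) (Ioo (-ε') ε' ×ˢ (univ : Set E)) := by
      refine hus.comp (contDiffOn_snd.prodMk contDiffOn_fst) ?_
      rintro ⟨t, x⟩ ⟨ht, -⟩
      exact ⟨mem_univ x, ht⟩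
    refine hus'.congr ?_
    rintro ⟨t, x⟩ ⟨ht, -⟩
    exact hgval t ht x
  · have hws' : ContDiffOn ℝ ∞ (fun p : ℝ × E => w p.2 p.1) (Ioo (-ε') ε' ×ˢ (univ : Set E)) := by
      refine hws.comp (contDiffOn_snd.prodMk contDiffOn_fst) ?_
      rintro ⟨t, x⟩ ⟨ht, -⟩
      exact ⟨mem_univ x, ht⟩
    refine hws'.congr ?_
    rintro ⟨t, x⟩ ⟨ht, -⟩
    exact hginv t ht x
  · intro t ht x
    have ht' : t ∈ Ioo (-ε') ε' := ⟨by linarith [ht.1], ht.2⟩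
    have hev : (fun s => (g s x : 𝔸)) =ᶠ[𝓝 t] fun s => u x s := by
      filter_upwards [isOpen_Ioo.mem_nhds ht'] with s hs
      exact hgval s hs x
    refine (hud x (mem_univ x) t ht').congr_of_eventuallyEq hev |>.congr_deriv ?_
    rw [hgval t ht' x, hΦf t ht.1 x]
  · intro t ht x
    have ht' : t ∈ Ioo (-ε') ε' := ⟨by linarith [ht.1], ht.2⟩
    have hev : (fun s => (((g s x)⁻¹ : 𝔸ˣ) : 𝔸)) =ᶠ[𝓝 t] fun s => w x s := by
      filter_upwards [isOpen_Ioo.mem_nhds ht'] with s hs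
      exact hginv s hs x
    refine (hwd x (mem_univ x) t ht').congr_of_eventuallyEq hev |>.congr_deriv ?_
    rw [hginv t ht' x, hΦf t ht.1 x]

end GaugeODE

end Literature.MathematicalPhysics.QuantumLattice
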